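import Summits.QuantumFields.YangMills.Theorems.FluctuationComparisonRegPrIntLOrganTangentMassOfSmallLiftAnyCut
import Summits.QuantumFields.YangMills.Theorems.FluctuationComparisonRegPrIntLOrganTangentTriangularChartAnyCut
import Summits.QuantumFields.YangMills.Theorems.FluctuationComparisonRegPrIntLOrganTangentDescendSection
import Summits.QuantumFields.YangMills.Theorems.FluctuationComparisonRegPrIntLSpreadLiftAllL
import Literature.MathematicalPhysics.QuantumFieldTheory.Balaban1983to89.T4AveragingDisintegration
import HarnessLib

/-!
# THE (A)-PACKAGE AT `descend`, COMPOSED (GENERIC CUT `cW`; every block size): TRIc ∘ DescendSection ∘ MASSc ∘ (β′), with the disintegration `σ_j` constructed —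
# «(A)-at-descend» at the v2.6 top `cW := 24∕25` MODULO the per-bond one-variable inverse LAW letters (M1) and the chart-side regularity∕margins (M2), DEFINITION-FREE

Cell `ym3-torus` (YM ladder rung R3 = continuum `SU(2)` Yang–Mills on the three-torus — a RUNG, NOT d = 4, NOT infinite volume, NOT a mass gap, NOT Clay).  Width seat
`ym-ust-20520-w4` (gen 21); `--supports stmt-QuantumFields-20520 --as helper`, count-neutral, definition-free, default heartbeats; no registry, binder or `Lines/`
edit; the registered skeleton `Lines/semiclassical_s2beta.lean` v11.4 and its five stubs are untouched (0∕5, ★★OWNER RULING №36).  Pen (d) named by LEAD-20520 w3 g22's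
■ FINAL NEXT (1) and ★★OWNER g38 №173 (3)(d)∕№175; generic-cut re-key (d)c per LEAD w3 g23 WORD №2 (iii) (ideator g26 №3 «R-CUT-χ (½, 24∕25)»).

WHAT THIS IS.  Row VER∘ `FibreMeanVersionCan` of LINE g25-1 «organ_tangent» holds from a height modulo the **(A)-PACKAGE** at the window constant `cW` — a regular small-field
disintegration of product Haar along Bałaban's averaging `descend F ℰp j` (one Markov disintegration `σ₀`; a finite fibre family `lam` with (A1) window-continuity of
`V ↦ ∫ f dlam_V` for continuous `f` supported in the `cW`-window, (A2) positive `lam_V`-mass of the `cW`-window, (A3) `∫ f dσ₀_V = c(V)·∫ f dlam_V` a.e.) — by LEAD's KNITc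
✓`OrganTangentFibreMeanVersionKnitAnyCut.fibreMeanVersion_of_regularSmallFieldDisintegration[_ac] (cW) (hcW : cW < 1)`.  LEAD w3 g22∕g23's road INTO the (A)-package at
`descend` has four legs: ✓`OrganTangentTriangularChartAnyCut.regularPackage_of_oneVariableInverseLaws (cW)` (TRIc: per-bond one-variable inverse laws in Bałaban's PRIVATE
coordinates ⟹ the T⁴ fibred chart ⟹ (A), for a given `σ₀`, a displayed SECTION `(s, hsm, hs)` and a displayed MASS letter `hmass`), ✓`OrganTangentDescendSection.exists_continuous_section_descend`
(the section binder DISCHARGED), ✓`OrganTangentMassOfSmallLiftAnyCut.mass_of_smallLift (cW)` (MASSc: `hmass` ⟸ (REG) joint openness∕continuity∕positivity of the chart data + (SOL)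
small fine fields solve their own coordinates + (LIFT) a `cW·θ_{j+1}`-small lift of every window datum) and ✓`SpreadLiftAllL.spreadLift_height_all` (px12 g19, (β′): the LIFT at
ANY gain `c > (3874825∕7077888)·√3 ≈ 0.948`, for EVERY family — odd `L ≥ 3` — from a height).  THIS FILE COMPOSES THEM: §0 the disintegration `σ_j` of product Haar along `descend`
with its three letters (Markov, `bind`, fibre) CONSTRUCTED route-free (`T4AveragingDisintegration.condLaw`, as in ✓`…OrganTangentKnitV17`); §1 ★`regularPackage_of_oneBondLaws_of_lift
(cW)` = TRIc with `(s, hsm, hs)` and `hmass` DISCHARGED (TRIc's fibrewise `hTo`∕`hθc` derived from MASSc's joint (REG) letters); §2 ★`exists_regularSmallFieldDisintegration_of_oneBondLaws_of_lift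
(cW)` = the (A)-package WITH ITS `σ₀` (the `∃ σ₀ lam, …` text of ✓p781986 `fibreMeanVersion_of_regular`'s `hA` at height `j` with `3 ∕ 4 ↦ cW`, token for token otherwise);
§3 ★★`exists_height_regularSmallFieldDisintegration_of_oneBondLaws` = for EVERY `F : T3Family`, in the regime `0 < γ ≤ 1, 0 < b₀, 0 < p₀`, FROM A HEIGHT `jV(F, γ, b₀, p₀)` ON,
the (A)-package at the v2.6 top `24 ∕ 25` holds MODULO EXACTLY the displayed per-bond letters at that top: (M1) `Ω T θ jac` + `hΩm hTm hθm hjm hΩbl hright hlaw hjc M hjM hjpos`;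
(M2) `T'` + `hT'T hmargin hΩS hsol` + joint `hTo hθc` — the residual binder list of record (w5 g21's (B1′) Stage 1∕(L6a)∕(L6b)∕(L7) + Stage 2 type exactly these); the numeral
`(3874825∕7077888)·√3 < 24∕25` is proved in place (`Real.sqrt_lt'`, `norm_num`).  No LIFT, SECTION, MASS or σ₀ letter remains, at any block size.

HONEST: a composition of landed theorems over hypothesis letters; (M1)(M2) are HYPOTHESES; nothing of Bałaban's analysis is asserted or proved; the (A)-package is proved only
modulo (M1)(M2); COAREA∘ ∕ VER∘ ∕ LIN∘ ∕ JEN∘ ∕ O1 ∕ crux 20520 `FluctuationComparisonRegPrIntL` ∕ `YM3TorusSU2` are NOT proved; no summit ∕ sub-problem statement is proved; rung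
R3 = SU(2) YM₃ on T³ — NOT d = 4, NOT infinite volume, NOT a mass gap, NOT Clay; the Yang–Mills mass gap is NOT proved by any of this.  All credit for the mathematics: LEAD w3
g22∕g23 ((L5) v2∕TRIc, DescendSection, MASS∕MASSc, the (A)-package), px12 g19 ((B4), (β′)), w5 g21 ((B1′)); this seat only composes.
[cite: Balaban1987RG1, (0.4) p.253, (0.13) p.254, (0.18) p.255, (2.10) p.267; Balaban1985Averaging, (10)-(13) p.19; Balaban1985UV3, (3) p.256 and (7) p.257]
-/

set_option autoImplicit false

noncomputable section

namespace Summit.QuantumFields.YangMills.Theorems.OrganTangentAPackageAtDescend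

open MeasureTheory ProbabilityTheory Filter Topology Set Function
open scoped ENNReal NNReal
open Literature.MathematicalPhysics.QuantumFieldTheory.Balaban1983to89
open T4Continuum T3ContinuumYM3Torus T3NestedUnitLaws T3UnitLawDensityEML T3UnitScaleTilt T3LevelShift
open Literature.MathematicalPhysics.QuantumFieldTheory.Balaban1983to89.T3OrbitAverage
open Literature.MathematicalPhysics.QuantumFieldTheory.Balaban1983to89.BlockAveragingHaarAC (centralBond)

/-! ## §0 The disintegration `σ_j` of product Haar along `descend`, constructed (route-free) -/

/-- **THE DISINTEGRATION `σ_j` OF PRODUCT HAAR ALONG BAŁABAN'S AVERAGING `descend F ℰp j`, WITH ITS THREE LETTERS** (Markov; `(descend_* dU_{j+1}).bind σ = dU_{j+1}`; `σ_V` lives on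
the fibre over `V`, a.e.) — the term of ✓`BackwardLiouvilleRigidity.FibreLaplace.stub_descentDisintegration` (`T4AveragingDisintegration.condLaw` on the standard Borel fine
space), re-derived here so that this file imports no route (`Theses/`) file. [cite: Balaban1985Averaging, (10)-(13) p.19] -/
theorem exists_descentDisintegration (F : T3Family) (j : ℕ) :
    ∃ σ : Kernel (GaugeField (F.P j) 0 ↥(Matrix.specialUnitaryGroup (Fin 2) ℂ)) (GaugeField (F.P (j + 1)) 0 ↥(Matrix.specialUnitaryGroup (Fin 2) ℂ)),
      IsMarkovKernel σ ∧
        (Measure.map (descend F ℰp j) (fieldMeasure (F.P (j + 1)) 0 ↥(Matrix.specialUnitaryGroup (Fin 2) ℂ))).bind ⇑σ =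
            fieldMeasure (F.P (j + 1)) 0 ↥(Matrix.specialUnitaryGroup (Fin 2) ℂ) ∧
          ∀ᵐ V ∂(Measure.map (descend F ℰp j) (fieldMeasure (F.P (j + 1)) 0 ↥(Matrix.specialUnitaryGroup (Fin 2) ℂ))),
            ∀ᵐ U ∂(σ V), descend F ℰp j U = V := by
  have havg : Measurable (descend F ℰp j : GaugeField (F.P (j + 1)) 0 ↥(Matrix.specialUnitaryGroup (Fin 2) ℂ) → GaugeField (F.P j) 0 ↥(Matrix.specialUnitaryGroup (Fin 2) ℂ)) :=
    measurable_descend F ℰp measurableE_ℰp j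
  haveI : Nonempty (GaugeField (F.P (j + 1)) 0 ↥(Matrix.specialUnitaryGroup (Fin 2) ℂ)) := ⟨fun _ => 1⟩
  refine ⟨T4AveragingDisintegration.condLaw (fieldMeasure (F.P (j + 1)) 0 ↥(Matrix.specialUnitaryGroup (Fin 2) ℂ)) (descend F ℰp j), inferInstance, ?_, ?_⟩
  · have h := T4AveragingDisintegration.fst_compProd_condLaw (fieldMeasure (F.P (j + 1)) 0 ↥(Matrix.specialUnitaryGroup (Fin 2) ℂ)) (descend F ℰp j)
    rw [T4AveragingDisintegration.jointLaw_fst _ havg] at h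
    have h2 := congrArg Measure.snd h
    rw [Measure.snd_compProd, T4AveragingDisintegration.jointLaw_snd _ havg] at h2
    exact h2
  · filter_upwards [T4AveragingDisintegration.condLaw_fibre_ae (fieldMeasure (F.P (j + 1)) 0 ↥(Matrix.specialUnitaryGroup (Fin 2) ℂ)) havg] with V hV
    rw [ae_iff]
    exact (prob_compl_eq_zero_iff (measurableSet_eq_fun havg measurable_const)).2 hV

/-! ## §1 TRIc with the SECTION and the MASS letters discharged (generic cut `cW`) -/

/-- ★ **PER-BOND ONE-VARIABLE INVERSE LAWS + (REG)(SOL)(LIFT) ⟹ THE (A)-PACKAGE at the window constant `cW`** (for a given disintegration `σ₀`):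
✓`OrganTangentTriangularChartAnyCut.regularPackage_of_oneVariableInverseLaws (cW)` with its SECTION binder `(s, hsm, hs)` supplied by ✓`exists_continuous_section_descend` and its
MASS letter `hmass` supplied by ✓`OrganTangentMassOfSmallLiftAnyCut.mass_of_smallLift (cW)`; TRIc's fibrewise `IsOpen (T c U)`∕`ContinuousOn (θ c U) (T c U)` are the `U`-slices
of the joint (REG) letters.  Binder texts: TRIc's ∕ MASSc's VERBATIM; conclusion = TRIc's (A)-package VERBATIM.
[cite: Balaban1987RG1, (0.4) p.253, (2.4) p.266 and (2.10) p.267; Balaban1985Averaging, (10) p.19] -/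
theorem regularPackage_of_oneBondLaws_of_lift
    (F : T3Family) (γ b₀ p₀ : ℝ) (j : ℕ) (cW : ℝ)
    (σ₀ : Kernel (GaugeField (F.P j) 0 ↥(Matrix.specialUnitaryGroup (Fin 2) ℂ))
      (GaugeField (F.P (j + 1)) 0 ↥(Matrix.specialUnitaryGroup (Fin 2) ℂ)))
    (hσ₀M : IsMarkovKernel σ₀)
    (hbind₀ : (Measure.map (descend F ℰp j) (fieldMeasure (F.P (j + 1)) 0 ↥(Matrix.specialUnitaryGroup (Fin 2) ℂ))).bind ⇑σ₀ =
      fieldMeasure (F.P (j + 1)) 0 ↥(Matrix.specialUnitaryGroup (Fin 2) ℂ))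
    (hfib₀ : ∀ᵐ V ∂(Measure.map (descend F ℰp j) (fieldMeasure (F.P (j + 1)) 0 ↥(Matrix.specialUnitaryGroup (Fin 2) ℂ))),
      ∀ᵐ U ∂(σ₀ V), descend F ℰp j U = V)
    (Ω T : PBond (F.P j) 0 → GaugeField (F.P (j + 1)) 0 ↥(Matrix.specialUnitaryGroup (Fin 2) ℂ) → Set ↥(Matrix.specialUnitaryGroup (Fin 2) ℂ))
    (θ : PBond (F.P j) 0 → GaugeField (F.P (j + 1)) 0 ↥(Matrix.specialUnitaryGroup (Fin 2) ℂ) →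
      ↥(Matrix.specialUnitaryGroup (Fin 2) ℂ) → ↥(Matrix.specialUnitaryGroup (Fin 2) ℂ))
    (jac : PBond (F.P j) 0 → GaugeField (F.P (j + 1)) 0 ↥(Matrix.specialUnitaryGroup (Fin 2) ℂ) → ↥(Matrix.specialUnitaryGroup (Fin 2) ℂ) → ℝ≥0)
    (hΩm : ∀ c, MeasurableSet {p : GaugeField (F.P (j + 1)) 0 ↥(Matrix.specialUnitaryGroup (Fin 2) ℂ) × ↥(Matrix.specialUnitaryGroup (Fin 2) ℂ) |
      p.2 ∈ Ω c p.1})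
    (hTm : ∀ c, MeasurableSet {p : GaugeField (F.P (j + 1)) 0 ↥(Matrix.specialUnitaryGroup (Fin 2) ℂ) × ↥(Matrix.specialUnitaryGroup (Fin 2) ℂ) |
      p.2 ∈ T c p.1})
    (hθm : ∀ c, Measurable fun p : GaugeField (F.P (j + 1)) 0 ↥(Matrix.specialUnitaryGroup (Fin 2) ℂ) × ↥(Matrix.specialUnitaryGroup (Fin 2) ℂ) =>
      θ c p.1 p.2)
    (hjm : ∀ c, Measurable fun p : GaugeField (F.P (j + 1)) 0 ↥(Matrix.specialUnitaryGroup (Fin 2) ℂ) × ↥(Matrix.specialUnitaryGroup (Fin 2) ℂ) =>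
      jac c p.1 p.2)
    (hΩbl : ∀ c (U : GaugeField (F.P (j + 1)) 0 ↥(Matrix.specialUnitaryGroup (Fin 2) ℂ)) (g : PBond (F.P j) 0 → ↥(Matrix.specialUnitaryGroup (Fin 2) ℂ)),
      Ω c (extend (fun c : PBond (F.P j) 0 => centralBond (bondShift (sitesPerDir_descend F j 0) c)) g U) = Ω c U)
    (hright : ∀ c U, ∀ v ∈ T c U,
      descend F ℰp j (update U (centralBond (bondShift (sitesPerDir_descend F j 0) c)) (θ c U v)) c = v)
    (hlaw : ∀ c U, (HaarData.haar : Measure ↥(Matrix.specialUnitaryGroup (Fin 2) ℂ)).restrict (Ω c U) =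
      (((HaarData.haar : Measure ↥(Matrix.specialUnitaryGroup (Fin 2) ℂ)).restrict (T c U)).withDensity fun v => (jac c U v : ℝ≥0∞)).map (θ c U))
    (T' : PBond (F.P j) 0 → GaugeField (F.P (j + 1)) 0 ↥(Matrix.specialUnitaryGroup (Fin 2) ℂ) → Set ↥(Matrix.specialUnitaryGroup (Fin 2) ℂ))
    (hT'T : ∀ c U, closure (T' c U) ⊆ T c U)
    (hmargin : ∀ (U : GaugeField (F.P (j + 1)) 0 ↥(Matrix.specialUnitaryGroup (Fin 2) ℂ)) (V : GaugeField (F.P j) 0 ↥(Matrix.specialUnitaryGroup (Fin 2) ℂ)),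
      PlaqSmall (θBal F.L γ b₀ p₀ j) V → (∀ c, V c ∈ T c U) →
      PlaqSmall (cW * θBal F.L γ b₀ p₀ (j + 1))
        (extend (fun c : PBond (F.P j) 0 => centralBond (bondShift (sitesPerDir_descend F j 0) c)) (fun c => θ c U (V c)) U) →
      ∀ c, V c ∈ T' c U)
    (hΩS : ∀ (U : GaugeField (F.P (j + 1)) 0 ↥(Matrix.specialUnitaryGroup (Fin 2) ℂ)), PlaqSmall (cW * θBal F.L γ b₀ p₀ (j + 1)) U →
      ∀ c, U (centralBond (bondShift (sitesPerDir_descend F j 0) c)) ∈ Ω c U)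
    (hjc : ∀ c U, ContinuousOn (fun v => (jac c U v : ℝ)) (T c U))
    (M : ℝ≥0) (hjM : ∀ c U v, jac c U v ≤ M)
    (hTo : ∀ c, IsOpen {p : GaugeField (F.P (j + 1)) 0 ↥(Matrix.specialUnitaryGroup (Fin 2) ℂ) × ↥(Matrix.specialUnitaryGroup (Fin 2) ℂ) |
      p.2 ∈ T c p.1})
    (hθc : ∀ c, ContinuousOn (fun p : GaugeField (F.P (j + 1)) 0 ↥(Matrix.specialUnitaryGroup (Fin 2) ℂ) × ↥(Matrix.specialUnitaryGroup (Fin 2) ℂ) =>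
      θ c p.1 p.2) {p | p.2 ∈ T c p.1})
    (hjpos : ∀ c U v, v ∈ T c U → 0 < jac c U v)
    (hsol : ∀ U : GaugeField (F.P (j + 1)) 0 ↥(Matrix.specialUnitaryGroup (Fin 2) ℂ), PlaqSmall (cW * θBal F.L γ b₀ p₀ (j + 1)) U →
      ∀ c, descend F ℰp j U c ∈ T c U ∧ θ c U (descend F ℰp j U c) = U (centralBond (bondShift (sitesPerDir_descend F j 0) c)))
    (hlift : ∀ V : GaugeField (F.P j) 0 ↥(Matrix.specialUnitaryGroup (Fin 2) ℂ), PlaqSmall (θBal F.L γ b₀ p₀ j) V →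
      ∃ U₀ : GaugeField (F.P (j + 1)) 0 ↥(Matrix.specialUnitaryGroup (Fin 2) ℂ),
        descend F ℰp j U₀ = V ∧ PlaqSmall (cW * θBal F.L γ b₀ p₀ (j + 1)) U₀) :
    ∃ lam : GaugeField (F.P j) 0 ↥(Matrix.specialUnitaryGroup (Fin 2) ℂ) →
        Measure (GaugeField (F.P (j + 1)) 0 ↥(Matrix.specialUnitaryGroup (Fin 2) ℂ)),
      (∀ V, IsFiniteMeasure (lam V)) ∧
      (∀ f : GaugeField (F.P (j + 1)) 0 ↥(Matrix.specialUnitaryGroup (Fin 2) ℂ) → ℝ, Continuous f →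
        (∀ U, f U ≠ 0 → PlaqSmall (cW * θBal F.L γ b₀ p₀ (j + 1)) U) →
        ContinuousOn (fun V => ∫ U, f U ∂(lam V)) {V | PlaqSmall (θBal F.L γ b₀ p₀ j) V}) ∧
      (∀ V, PlaqSmall (θBal F.L γ b₀ p₀ j) V → 0 < lam V {U | PlaqSmall (cW * θBal F.L γ b₀ p₀ (j + 1)) U}) ∧
      (∃ c : GaugeField (F.P j) 0 ↥(Matrix.specialUnitaryGroup (Fin 2) ℂ) → ℝ,
        ∀ f : GaugeField (F.P (j + 1)) 0 ↥(Matrix.specialUnitaryGroup (Fin 2) ℂ) → ℝ, Continuous f →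
          (∀ U, ¬ PlaqSmall (cW * θBal F.L γ b₀ p₀ (j + 1)) U → f U = 0) →
          ∀ᵐ V ∂(Measure.map (descend F ℰp j) (fieldMeasure (F.P (j + 1)) 0 ↥(Matrix.specialUnitaryGroup (Fin 2) ℂ))),
            PlaqSmall (θBal F.L γ b₀ p₀ j) V → 0 < c V ∧ ∫ U, f U ∂(σ₀ V) = c V * ∫ U, f U ∂(lam V)) := by
  obtain ⟨s, _hsc, hsm, hs, _hgain⟩ := OrganTangentDescendSection.exists_continuous_section_descend F j
  have hTo' : ∀ c U, IsOpen (T c U) := fun c U => (hTo c).preimage (Continuous.prodMk_right U)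
  have hθc' : ∀ c U, ContinuousOn (θ c U) (T c U) := fun c U =>
    (hθc c).comp (Continuous.prodMk_right U).continuousOn fun v hv => hv
  have hmass := OrganTangentMassOfSmallLiftAnyCut.mass_of_smallLift F γ b₀ p₀ j cW T θ jac hTo hθc hjm hjpos hsol hlift
  exact OrganTangentTriangularChartAnyCut.regularPackage_of_oneVariableInverseLaws F γ b₀ p₀ j cW σ₀ hσ₀M hbind₀ hfib₀ Ω T θ jac hΩm hTm hθm hjm
    hΩbl hright hlaw T' hTo' hT'T hmargin s hsm (fun V _ => hs V) hΩS hθc' hjc M hjM hmass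

/-! ## §2 The (A)-package WITH its disintegration (generic cut `cW`) -/

/-- ★ **PER-BOND ONE-VARIABLE INVERSE LAWS + (REG)(SOL)(LIFT) ⟹ THE (A)-PACKAGE WITH ITS `σ₀`, at the window constant `cW`** — the `∃ σ₀ lam, …` text of
✓`…OrganTangentRegularVersion.fibreMeanVersion_of_regular`'s hypothesis `hA` at height `j` with `3 ∕ 4 ↦ cW` (token for token otherwise): §1 at the disintegration of §0.
[cite: Balaban1987RG1, (0.4) p.253, (2.10) p.267; Balaban1985Averaging, (10)-(13) p.19] -/
theorem exists_regularSmallFieldDisintegration_of_oneBondLaws_of_lift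
    (F : T3Family) (γ b₀ p₀ : ℝ) (j : ℕ) (cW : ℝ)
    (Ω T : PBond (F.P j) 0 → GaugeField (F.P (j + 1)) 0 ↥(Matrix.specialUnitaryGroup (Fin 2) ℂ) → Set ↥(Matrix.specialUnitaryGroup (Fin 2) ℂ))
    (θ : PBond (F.P j) 0 → GaugeField (F.P (j + 1)) 0 ↥(Matrix.specialUnitaryGroup (Fin 2) ℂ) →
      ↥(Matrix.specialUnitaryGroup (Fin 2) ℂ) → ↥(Matrix.specialUnitaryGroup (Fin 2) ℂ))
    (jac : PBond (F.P j) 0 → GaugeField (F.P (j + 1)) 0 ↥(Matrix.specialUnitaryGroup (Fin 2) ℂ) → ↥(Matrix.specialUnitaryGroup (Fin 2) ℂ) → ℝ≥0)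
    (hΩm : ∀ c, MeasurableSet {p : GaugeField (F.P (j + 1)) 0 ↥(Matrix.specialUnitaryGroup (Fin 2) ℂ) × ↥(Matrix.specialUnitaryGroup (Fin 2) ℂ) |
      p.2 ∈ Ω c p.1})
    (hTm : ∀ c, MeasurableSet {p : GaugeField (F.P (j + 1)) 0 ↥(Matrix.specialUnitaryGroup (Fin 2) ℂ) × ↥(Matrix.specialUnitaryGroup (Fin 2) ℂ) |
      p.2 ∈ T c p.1})
    (hθm : ∀ c, Measurable fun p : GaugeField (F.P (j + 1)) 0 ↥(Matrix.specialUnitaryGroup (Fin 2) ℂ) × ↥(Matrix.specialUnitaryGroup (Fin 2) ℂ) =>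
      θ c p.1 p.2)
    (hjm : ∀ c, Measurable fun p : GaugeField (F.P (j + 1)) 0 ↥(Matrix.specialUnitaryGroup (Fin 2) ℂ) × ↥(Matrix.specialUnitaryGroup (Fin 2) ℂ) =>
      jac c p.1 p.2)
    (hΩbl : ∀ c (U : GaugeField (F.P (j + 1)) 0 ↥(Matrix.specialUnitaryGroup (Fin 2) ℂ)) (g : PBond (F.P j) 0 → ↥(Matrix.specialUnitaryGroup (Fin 2) ℂ)),
      Ω c (extend (fun c : PBond (F.P j) 0 => centralBond (bondShift (sitesPerDir_descend F j 0) c)) g U) = Ω c U)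
    (hright : ∀ c U, ∀ v ∈ T c U,
      descend F ℰp j (update U (centralBond (bondShift (sitesPerDir_descend F j 0) c)) (θ c U v)) c = v)
    (hlaw : ∀ c U, (HaarData.haar : Measure ↥(Matrix.specialUnitaryGroup (Fin 2) ℂ)).restrict (Ω c U) =
      (((HaarData.haar : Measure ↥(Matrix.specialUnitaryGroup (Fin 2) ℂ)).restrict (T c U)).withDensity fun v => (jac c U v : ℝ≥0∞)).map (θ c U))
    (T' : PBond (F.P j) 0 → GaugeField (F.P (j + 1)) 0 ↥(Matrix.specialUnitaryGroup (Fin 2) ℂ) → Set ↥(Matrix.specialUnitaryGroup (Fin 2) ℂ))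
    (hT'T : ∀ c U, closure (T' c U) ⊆ T c U)
    (hmargin : ∀ (U : GaugeField (F.P (j + 1)) 0 ↥(Matrix.specialUnitaryGroup (Fin 2) ℂ)) (V : GaugeField (F.P j) 0 ↥(Matrix.specialUnitaryGroup (Fin 2) ℂ)),
      PlaqSmall (θBal F.L γ b₀ p₀ j) V → (∀ c, V c ∈ T c U) →
      PlaqSmall (cW * θBal F.L γ b₀ p₀ (j + 1))
        (extend (fun c : PBond (F.P j) 0 => centralBond (bondShift (sitesPerDir_descend F j 0) c)) (fun c => θ c U (V c)) U) →
      ∀ c, V c ∈ T' c U)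
    (hΩS : ∀ (U : GaugeField (F.P (j + 1)) 0 ↥(Matrix.specialUnitaryGroup (Fin 2) ℂ)), PlaqSmall (cW * θBal F.L γ b₀ p₀ (j + 1)) U →
      ∀ c, U (centralBond (bondShift (sitesPerDir_descend F j 0) c)) ∈ Ω c U)
    (hjc : ∀ c U, ContinuousOn (fun v => (jac c U v : ℝ)) (T c U))
    (M : ℝ≥0) (hjM : ∀ c U v, jac c U v ≤ M)
    (hTo : ∀ c, IsOpen {p : GaugeField (F.P (j + 1)) 0 ↥(Matrix.specialUnitaryGroup (Fin 2) ℂ) × ↥(Matrix.specialUnitaryGroup (Fin 2) ℂ) |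
      p.2 ∈ T c p.1})
    (hθc : ∀ c, ContinuousOn (fun p : GaugeField (F.P (j + 1)) 0 ↥(Matrix.specialUnitaryGroup (Fin 2) ℂ) × ↥(Matrix.specialUnitaryGroup (Fin 2) ℂ) =>
      θ c p.1 p.2) {p | p.2 ∈ T c p.1})
    (hjpos : ∀ c U v, v ∈ T c U → 0 < jac c U v)
    (hsol : ∀ U : GaugeField (F.P (j + 1)) 0 ↥(Matrix.specialUnitaryGroup (Fin 2) ℂ), PlaqSmall (cW * θBal F.L γ b₀ p₀ (j + 1)) U →
      ∀ c, descend F ℰp j U c ∈ T c U ∧ θ c U (descend F ℰp j U c) = U (centralBond (bondShift (sitesPerDir_descend F j 0) c)))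
    (hlift : ∀ V : GaugeField (F.P j) 0 ↥(Matrix.specialUnitaryGroup (Fin 2) ℂ), PlaqSmall (θBal F.L γ b₀ p₀ j) V →
      ∃ U₀ : GaugeField (F.P (j + 1)) 0 ↥(Matrix.specialUnitaryGroup (Fin 2) ℂ),
        descend F ℰp j U₀ = V ∧ PlaqSmall (cW * θBal F.L γ b₀ p₀ (j + 1)) U₀) :
      ∃ (σ₀ : ProbabilityTheory.Kernel (GaugeField (F.P j) 0 ↥(Matrix.specialUnitaryGroup (Fin 2) ℂ))
          (GaugeField (F.P (j + 1)) 0 ↥(Matrix.specialUnitaryGroup (Fin 2) ℂ)))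
        (lam : GaugeField (F.P j) 0 ↥(Matrix.specialUnitaryGroup (Fin 2) ℂ) →
          Measure (GaugeField (F.P (j + 1)) 0 ↥(Matrix.specialUnitaryGroup (Fin 2) ℂ))),
        ProbabilityTheory.IsMarkovKernel σ₀ ∧
        (Measure.map (descend F ℰp j) (fieldMeasure (F.P (j + 1)) 0 ↥(Matrix.specialUnitaryGroup (Fin 2) ℂ))).bind ⇑σ₀ =
          fieldMeasure (F.P (j + 1)) 0 ↥(Matrix.specialUnitaryGroup (Fin 2) ℂ) ∧
        (∀ᵐ V ∂(Measure.map (descend F ℰp j) (fieldMeasure (F.P (j + 1)) 0 ↥(Matrix.specialUnitaryGroup (Fin 2) ℂ))),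
          ∀ᵐ U ∂(σ₀ V), descend F ℰp j U = V) ∧
        (∀ V, IsFiniteMeasure (lam V)) ∧
        (∀ f : GaugeField (F.P (j + 1)) 0 ↥(Matrix.specialUnitaryGroup (Fin 2) ℂ) → ℝ, Continuous f →
          (∀ U, f U ≠ 0 → PlaqSmall (cW * θBal F.L γ b₀ p₀ (j + 1)) U) →
          ContinuousOn (fun V => ∫ U, f U ∂(lam V)) {V | PlaqSmall (θBal F.L γ b₀ p₀ j) V}) ∧
        (∀ V, PlaqSmall (θBal F.L γ b₀ p₀ j) V → 0 < lam V {U | PlaqSmall (cW * θBal F.L γ b₀ p₀ (j + 1)) U}) ∧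
        (∃ c : GaugeField (F.P j) 0 ↥(Matrix.specialUnitaryGroup (Fin 2) ℂ) → ℝ,
          ∀ f : GaugeField (F.P (j + 1)) 0 ↥(Matrix.specialUnitaryGroup (Fin 2) ℂ) → ℝ, Continuous f →
            (∀ U, ¬ PlaqSmall (cW * θBal F.L γ b₀ p₀ (j + 1)) U → f U = 0) →
            ∀ᵐ V ∂(Measure.map (descend F ℰp j) (fieldMeasure (F.P (j + 1)) 0 ↥(Matrix.specialUnitaryGroup (Fin 2) ℂ))),
              PlaqSmall (θBal F.L γ b₀ p₀ j) V → 0 < c V ∧ ∫ U, f U ∂(σ₀ V) = c V * ∫ U, f U ∂(lam V)) := by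
  obtain ⟨σ₀, hσ₀M, hbind₀, hfib₀⟩ := exists_descentDisintegration F j
  obtain ⟨lam, hlam, hA1, hA2, hA3⟩ := regularPackage_of_oneBondLaws_of_lift F γ b₀ p₀ j cW σ₀ hσ₀M hbind₀ hfib₀ Ω T θ jac hΩm hTm hθm hjm
    hΩbl hright hlaw T' hT'T hmargin hΩS hjc M hjM hTo hθc hjpos hsol hlift
  exact ⟨σ₀, lam, hσ₀M, hbind₀, hfib₀, hlam, hA1, hA2, hA3⟩

/-! ## §3 From a height, for EVERY family, at the v2.6 top `24∕25`: the LIFT letter is (β′)'s theorem -/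

/-- The v2.6 top clears (β′)'s gain floor: `(3874825∕7077888)·√3 < 24∕25` (`0.9482… < 0.96`). [folklore] -/
theorem liftFloor_lt_twentyFour_div_twentyFive : (3874825 / 7077888 : ℝ) * Real.sqrt ((3 : ℕ) : ℝ) < 24 / 25 := by
  have h3 : Real.sqrt ((3 : ℕ) : ℝ) < 24 * 7077888 / (25 * 3874825) := by
    rw [Real.sqrt_lt' (by norm_num)]; norm_num
  calc (3874825 / 7077888 : ℝ) * Real.sqrt ((3 : ℕ) : ℝ) < (3874825 / 7077888 : ℝ) * (24 * 7077888 / (25 * 3874825)) :=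
        mul_lt_mul_of_pos_left h3 (by norm_num)
    _ = 24 / 25 := by norm_num

/-- ★★ **«(A)-AT-DESCEND» AT THE v2.6 TOP `24∕25`, MODULO (M1)(M2), FOR EVERY FAMILY.**  In the regime `0 < γ ≤ 1`, `0 < b₀`, `0 < p₀` there is a height `jV` such that for every
`j ≥ jV` the (A)-package at height `j` and window constant `24∕25` (the `∃ σ₀ lam, …` text of ✓`fibreMeanVersion_of_regular`'s `hA` with `3 ∕ 4 ↦ 24 ∕ 25`) holds for ANY per-bond
one-variable inverse-law data `Ω T θ jac` with inner domains `T'` satisfying the displayed letters (M1) `hΩm hTm hθm hjm hΩbl hright hlaw hjc hjM hjpos` and (M2) `hT'T hmargin hΩS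
hsol hTo hθc` at that top — the LIFT being ✓`SpreadLiftAllL.spreadLift_height_all` (px12 g19: every `F : T3Family`, gain floor cleared by `liftFloor_lt_twentyFour_div_twentyFive`),
the SECTION ✓`exists_continuous_section_descend`, the MASS §1, the disintegration §0.
[cite: Balaban1987RG1, (0.4) p.253, (0.18) p.255, (2.10) p.267; Balaban1985UV3, (3) p.256 and (7) p.257; Balaban1985Averaging, (10)-(13) p.19] -/
theorem exists_height_regularSmallFieldDisintegration_of_oneBondLaws
    (F : T3Family) (γ b₀ p₀ : ℝ) (hγ : 0 < γ) (hγ1 : γ ≤ 1) (hb₀ : 0 < b₀) (hp₀ : 0 < p₀) :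
    ∃ jV : ℕ, ∀ (j : ℕ), jV ≤ j →
      ∀
      (Ω T : PBond (F.P j) 0 → GaugeField (F.P (j + 1)) 0 ↥(Matrix.specialUnitaryGroup (Fin 2) ℂ) → Set ↥(Matrix.specialUnitaryGroup (Fin 2) ℂ))
      (θ : PBond (F.P j) 0 → GaugeField (F.P (j + 1)) 0 ↥(Matrix.specialUnitaryGroup (Fin 2) ℂ) →
        ↥(Matrix.specialUnitaryGroup (Fin 2) ℂ) → ↥(Matrix.specialUnitaryGroup (Fin 2) ℂ))
      (jac : PBond (F.P j) 0 → GaugeField (F.P (j + 1)) 0 ↥(Matrix.specialUnitaryGroup (Fin 2) ℂ) → ↥(Matrix.specialUnitaryGroup (Fin 2) ℂ) → ℝ≥0)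
      (hΩm : ∀ c, MeasurableSet {p : GaugeField (F.P (j + 1)) 0 ↥(Matrix.specialUnitaryGroup (Fin 2) ℂ) × ↥(Matrix.specialUnitaryGroup (Fin 2) ℂ) |
        p.2 ∈ Ω c p.1})
      (hTm : ∀ c, MeasurableSet {p : GaugeField (F.P (j + 1)) 0 ↥(Matrix.specialUnitaryGroup (Fin 2) ℂ) × ↥(Matrix.specialUnitaryGroup (Fin 2) ℂ) |
        p.2 ∈ T c p.1})
      (hθm : ∀ c, Measurable fun p : GaugeField (F.P (j + 1)) 0 ↥(Matrix.specialUnitaryGroup (Fin 2) ℂ) × ↥(Matrix.specialUnitaryGroup (Fin 2) ℂ) =>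
        θ c p.1 p.2)
      (hjm : ∀ c, Measurable fun p : GaugeField (F.P (j + 1)) 0 ↥(Matrix.specialUnitaryGroup (Fin 2) ℂ) × ↥(Matrix.specialUnitaryGroup (Fin 2) ℂ) =>
        jac c p.1 p.2)
      (hΩbl : ∀ c (U : GaugeField (F.P (j + 1)) 0 ↥(Matrix.specialUnitaryGroup (Fin 2) ℂ)) (g : PBond (F.P j) 0 → ↥(Matrix.specialUnitaryGroup (Fin 2) ℂ)),
        Ω c (extend (fun c : PBond (F.P j) 0 => centralBond (bondShift (sitesPerDir_descend F j 0) c)) g U) = Ω c U)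
      (hright : ∀ c U, ∀ v ∈ T c U,
        descend F ℰp j (update U (centralBond (bondShift (sitesPerDir_descend F j 0) c)) (θ c U v)) c = v)
      (hlaw : ∀ c U, (HaarData.haar : Measure ↥(Matrix.specialUnitaryGroup (Fin 2) ℂ)).restrict (Ω c U) =
        (((HaarData.haar : Measure ↥(Matrix.specialUnitaryGroup (Fin 2) ℂ)).restrict (T c U)).withDensity fun v => (jac c U v : ℝ≥0∞)).map (θ c U))
      (T' : PBond (F.P j) 0 → GaugeField (F.P (j + 1)) 0 ↥(Matrix.specialUnitaryGroup (Fin 2) ℂ) → Set ↥(Matrix.specialUnitaryGroup (Fin 2) ℂ))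
      (hT'T : ∀ c U, closure (T' c U) ⊆ T c U)
      (hmargin : ∀ (U : GaugeField (F.P (j + 1)) 0 ↥(Matrix.specialUnitaryGroup (Fin 2) ℂ)) (V : GaugeField (F.P j) 0 ↥(Matrix.specialUnitaryGroup (Fin 2) ℂ)),
        PlaqSmall (θBal F.L γ b₀ p₀ j) V → (∀ c, V c ∈ T c U) →
        PlaqSmall (24 / 25 * θBal F.L γ b₀ p₀ (j + 1))
          (extend (fun c : PBond (F.P j) 0 => centralBond (bondShift (sitesPerDir_descend F j 0) c)) (fun c => θ c U (V c)) U) →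
        ∀ c, V c ∈ T' c U)
      (hΩS : ∀ (U : GaugeField (F.P (j + 1)) 0 ↥(Matrix.specialUnitaryGroup (Fin 2) ℂ)), PlaqSmall (24 / 25 * θBal F.L γ b₀ p₀ (j + 1)) U →
        ∀ c, U (centralBond (bondShift (sitesPerDir_descend F j 0) c)) ∈ Ω c U)
      (hjc : ∀ c U, ContinuousOn (fun v => (jac c U v : ℝ)) (T c U))
      (M : ℝ≥0) (hjM : ∀ c U v, jac c U v ≤ M)
      (hTo : ∀ c, IsOpen {p : GaugeField (F.P (j + 1)) 0 ↥(Matrix.specialUnitaryGroup (Fin 2) ℂ) × ↥(Matrix.specialUnitaryGroup (Fin 2) ℂ) |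
        p.2 ∈ T c p.1})
      (hθc : ∀ c, ContinuousOn (fun p : GaugeField (F.P (j + 1)) 0 ↥(Matrix.specialUnitaryGroup (Fin 2) ℂ) × ↥(Matrix.specialUnitaryGroup (Fin 2) ℂ) =>
        θ c p.1 p.2) {p | p.2 ∈ T c p.1})
      (hjpos : ∀ c U v, v ∈ T c U → 0 < jac c U v)
      (hsol : ∀ U : GaugeField (F.P (j + 1)) 0 ↥(Matrix.specialUnitaryGroup (Fin 2) ℂ), PlaqSmall (24 / 25 * θBal F.L γ b₀ p₀ (j + 1)) U →
        ∀ c, descend F ℰp j U c ∈ T c U ∧ θ c U (descend F ℰp j U c) = U (centralBond (bondShift (sitesPerDir_descend F j 0) c))),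
          ∃ (σ₀ : ProbabilityTheory.Kernel (GaugeField (F.P j) 0 ↥(Matrix.specialUnitaryGroup (Fin 2) ℂ))
              (GaugeField (F.P (j + 1)) 0 ↥(Matrix.specialUnitaryGroup (Fin 2) ℂ)))
            (lam : GaugeField (F.P j) 0 ↥(Matrix.specialUnitaryGroup (Fin 2) ℂ) →
              Measure (GaugeField (F.P (j + 1)) 0 ↥(Matrix.specialUnitaryGroup (Fin 2) ℂ))),
            ProbabilityTheory.IsMarkovKernel σ₀ ∧
            (Measure.map (descend F ℰp j) (fieldMeasure (F.P (j + 1)) 0 ↥(Matrix.specialUnitaryGroup (Fin 2) ℂ))).bind ⇑σ₀ =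
              fieldMeasure (F.P (j + 1)) 0 ↥(Matrix.specialUnitaryGroup (Fin 2) ℂ) ∧
            (∀ᵐ V ∂(Measure.map (descend F ℰp j) (fieldMeasure (F.P (j + 1)) 0 ↥(Matrix.specialUnitaryGroup (Fin 2) ℂ))),
              ∀ᵐ U ∂(σ₀ V), descend F ℰp j U = V) ∧
            (∀ V, IsFiniteMeasure (lam V)) ∧
            (∀ f : GaugeField (F.P (j + 1)) 0 ↥(Matrix.specialUnitaryGroup (Fin 2) ℂ) → ℝ, Continuous f →
              (∀ U, f U ≠ 0 → PlaqSmall (24 / 25 * θBal F.L γ b₀ p₀ (j + 1)) U) →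
              ContinuousOn (fun V => ∫ U, f U ∂(lam V)) {V | PlaqSmall (θBal F.L γ b₀ p₀ j) V}) ∧
            (∀ V, PlaqSmall (θBal F.L γ b₀ p₀ j) V → 0 < lam V {U | PlaqSmall (24 / 25 * θBal F.L γ b₀ p₀ (j + 1)) U}) ∧
            (∃ c : GaugeField (F.P j) 0 ↥(Matrix.specialUnitaryGroup (Fin 2) ℂ) → ℝ,
              ∀ f : GaugeField (F.P (j + 1)) 0 ↥(Matrix.specialUnitaryGroup (Fin 2) ℂ) → ℝ, Continuous f →
                (∀ U, ¬ PlaqSmall (24 / 25 * θBal F.L γ b₀ p₀ (j + 1)) U → f U = 0) →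
                ∀ᵐ V ∂(Measure.map (descend F ℰp j) (fieldMeasure (F.P (j + 1)) 0 ↥(Matrix.specialUnitaryGroup (Fin 2) ℂ))),
                  PlaqSmall (θBal F.L γ b₀ p₀ j) V → 0 < c V ∧ ∫ U, f U ∂(σ₀ V) = c V * ∫ U, f U ∂(lam V)) := by
  obtain ⟨jV, hjV⟩ := SpreadLiftAllL.spreadLift_height_all liftFloor_lt_twentyFour_div_twentyFive F hγ hγ1 hb₀ hp₀.le
  refine ⟨jV, fun j hj => ?_⟩
  intro Ω T θ jac hΩm hTm hθm hjm hΩbl hright hlaw T' hT'T hmargin hΩS hjc M hjM hTo hθc hjpos hsol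
  exact exists_regularSmallFieldDisintegration_of_oneBondLaws_of_lift F γ b₀ p₀ j (24 / 25) Ω T θ jac hΩm hTm hθm hjm hΩbl hright hlaw T' hT'T
    hmargin hΩS hjc M hjM hTo hθc hjpos hsol (hjV j hj)

end Summit.QuantumFields.YangMills.Theorems.OrganTangentAPackageAtDescend

end
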